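import Mathlib.Analysis.Complex.RemovableSingularity
import Literature.Analysis.Convolution.RenewalResolventSymbol
import Literature.Analysis.Complex.VerticalLineShiftPoles
import HarnessLib

/-!
# The resolvent of an exponentially decaying renewal kernel, II: `r(t) = e^{t}/E′(1) + O(e^{−βt})`
# (weighted half-line Paley–Wiener theorem for resolvents, simple-pole case)

Topic `Literature/Analysis/Convolution`; continuation of `RenewalResolventSymbol.lean` (hypothesis structure `RenewalPoleData`,
Steps 1–3). Everything here is PROVED.

THE THEOREM (`RenewalPoleData.norm_resolvent_sub_exp_le`). Under `RenewalPoleData k k' r E K μ R a₀ β β₀` — `k ∈ C¹[0,∞)` with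
`‖k‖, ‖k′‖ ≤ K e^{−μt}`, `r` continuous of exponential order with `r = k + k ⋆ r` on `[0,∞)`, symbol `E = 1 − 𝓛k` with
`E ≠ 0` on `{Re σ > −β₀} ∖ {1}`, `E(1) = 0`, `E′(1) ≠ 0`, `0 < β < β₀ ≤ μ` — there is `N` with
    `‖r(t) − e^{t}/E′(1)‖ ≤ N e^{−βt}`   for all `t ≥ 0`,
and (`integral_norm_resolvent_sub_exp_le`) for every `β′ < β` the remainder lies in `L¹(e^{β′t}dt)` with uniformly bounded partial
integrals — the hypothesis shape of `Summit.NavierStokesRegularity.OSWSelfSimilar.SheetRRenewalBookkeeping.norm_renewal_sub_growing_le`.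
Classical source: Gripenberg–Londen–Staffans 1990, Ch. 7 Thm 2.1 (citation = provenance only; everything is proved here).

PROOF (Schiff 1999 §4.1–4.2 made rigorous with absolutely convergent Bromwich integrals). Step 4: on the right line `Re σ = a`
(`a > max(a₀, 1)`, `a ≥ 2K`) `‖𝓛k‖ ≤ 1/2`, so `E ≠ 0`, and Bromwich inversion (`HalfLineExpBound.eq_integral_laplaceC_vertical`,
Mathlib's Mellin inversion) gives `r(t) − k(t) = (1/2π)∫ e^{(a+iy)t}Φ(a+iy) dy`. Step 5: near `σ = 1`,
`e^{σt}Φ(σ) = φ(σ)/(σ − 1)` with `φ = e^{σt}(𝓛k)²/dslope E 1` holomorphic (Mathlib's removable-singularity `dslope`),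
`φ(1) = e^{t}/E′(1)` since `𝓛k(1) = 1`; the tree's `Literature.Analysis.Complex.integral_vertical_sub_eq_sum_of_poles` shifts the
line to `Re σ = −β` (horizontal sides vanish by the `2C₁²/(Im σ)²` bound). Step 6: the shifted integral is
`≤ e^{−βt}∫‖Φ(−β+iy)‖dy`, and `‖k(t)‖ ≤ K e^{−μt} ≤ K e^{−βt}`.

USE (cell ns-blowup, Z3-SR-SPEC «linearly stable modulo gauge», memo P9-P10-RENEWAL-DESIGN v2, brick (R-c)): `k(t) = θ⟪h, S(t)f⟫`
for a contraction semigroup `S` and `f ∈ D(T)`, `E` = the Evans function of record. NOT here: existence of `r` (Picard iteration),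
operators, any model.

## References
* G. Gripenberg, S.-O. Londen, O. Staffans, *Volterra Integral and Functional Equations*, CUP 1990, Ch. 7 Thm 2.1. [GripenbergLondenStaffans1990]
* J. L. Schiff, *The Laplace Transform*, Springer 1999, §4.1 (4.3), Thm 4.3. [Schiff1999]
-/

noncomputable section

open _root_.Complex _root_.MeasureTheory _root_.Set _root_.Filter _root_.Real
open scoped _root_.Topology
open Literature.Analysis.Complex

namespace Literature.Analysis.Convolution

namespace RenewalPoleData

variable {k k' r : ℝ → ℂ} {E : ℂ → ℂ} {K μ R a₀ β β₀ : ℝ}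

/-! ### Step 4: the right line `Re σ = a` -/

/-- On `Re σ ≥ a` with `a ≥ 2K`, `a > 0`: `‖𝓛k(σ)‖ ≤ 1/2`. [cite: Schiff1999, Theorem 1.11 (proof)] -/
theorem norm_laplaceC_k_le_half (h : RenewalPoleData k k' r E K μ R a₀ β β₀) {a : ℝ} (ha : 0 < a) (haK : 2 * K ≤ a)
    {s : ℂ} (hs : a ≤ s.re) : ‖laplaceC k s‖ ≤ 1 / 2 := by
  have hsμ : -μ < s.re := by linarith [h.hμ]
  refine (h.hk.norm_laplaceC_le hsμ).trans ?_
  rw [sub_neg_eq_add, div_le_iff₀ (by linarith [h.hμ])]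
  linarith [h.hμ, h.hk.nonneg]

/-- On the right line `E ≠ 0`. [cite: Schiff1999, Theorem 1.11 (proof)] -/
theorem E_ne_zero_right (h : RenewalPoleData k k' r E K μ R a₀ β β₀) {a : ℝ} (ha : 0 < a) (haK : 2 * K ≤ a)
    {s : ℂ} (hs : a ≤ s.re) : E s ≠ 0 := by
  have := h.half_le_norm_E (by linarith [h.hμ]) (h.norm_laplaceC_k_le_half ha haK hs)
  intro h0; rw [h0, norm_zero] at this; linarith

/-- **Bromwich representation of `r − k` on the right line**: for `a > max(a₀, 0)`, `a ≥ 2K`, and `t > 0`,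
`r(t) − k(t) = (1/2π) ∫ e^{(a+iy)t} Φ(a + iy) dy`. [cite: Schiff1999, §4.1 (4.3)] -/
theorem sub_eq_integral_right (h : RenewalPoleData k k' r E K μ R a₀ β β₀) {a : ℝ} (ha : 0 < a) (ha₀ : a₀ < a)
    (haK : 2 * K ≤ a) {t : ℝ} (ht : 0 < t) :
    r t - k t = (1 / (2 * π) : ℝ) • ∫ y : ℝ, cexp ((a + y * I) * t) *
      ((laplaceC k (a + y * I)) ^ 2 / E (a + y * I)) := by
  -- `ρ = r − k` has exponential order `max a₀ 0`
  have hρ : HalfLineExpBound (fun t => r t - k t) (R + K) (max a₀ 0) :=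
    (h.hr.mono (le_max_left _ _)).sub (h.hk.mono (by linarith [le_max_right a₀ 0, h.hμ] : -μ ≤ max a₀ 0))
  have hline : ∀ y : ℝ, laplaceC (fun t => r t - k t) (a + y * I) =
      (laplaceC k (a + y * I)) ^ 2 / E (a + y * I) := fun y =>
    h.laplaceC_sub_eq (by simp; linarith [h.hμ]) (by simpa using ha₀) (h.E_ne_zero_right ha haK (by simp))
  have hV : Integrable fun y : ℝ => laplaceC (fun t => r t - k t) (a + y * I) := by
    rw [show (fun y : ℝ => laplaceC (fun t => r t - k t) (a + y * I)) =
        fun y : ℝ => (laplaceC k (a + y * I)) ^ 2 / E (a + y * I) from funext hline]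
    exact h.integrable_sq_div_vertical (by linarith [h.hβ]) fun y => h.E_ne_zero_right ha haK (by simp)
  have key := hρ.eq_integral_laplaceC_vertical (max_lt ha₀ ha) hV ht
  simp only [hline] at key
  exact key

/-! ### Step 5: the pole at `σ = 1` and the contour shift -/

/-- The local structure at the simple zero: near `1`, `e^{σt}Φ(σ) = φ(σ)/(σ − 1)` with `φ` holomorphic and
`φ(1) = e^{t}/E′(1)`. [cite: Schiff1999, Theorem 4.3 / (3.21) (residue at a simple pole)] -/
theorem pole_structure (h : RenewalPoleData k k' r E K μ R a₀ β β₀) (t : ℝ) :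
    ∃ V ∈ 𝓝 (1 : ℂ), DifferentiableOn ℂ (fun z => cexp (z * t) * (laplaceC k z) ^ 2 / dslope E 1 z) V ∧
      (∀ z ∈ V, z ≠ 1 → cexp (z * t) * ((laplaceC k z) ^ 2 / E z) =
        (cexp (z * t) * (laplaceC k z) ^ 2 / dslope E 1 z) / (z - 1) ^ (0 + 1)) ∧
      cexp ((1 : ℂ) * t) * (laplaceC k 1) ^ 2 / dslope E 1 1 = cexp t / deriv E 1 := by
  set V₀ : Set ℂ := {s : ℂ | -μ < s.re} with hV₀
  have hV₀open : IsOpen V₀ := isOpen_lt continuous_const Complex.continuous_re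
  have h1V₀ : (1 : ℂ) ∈ V₀ := by simp [hV₀]; linarith [h.hμ]
  have hV₀nhds : V₀ ∈ 𝓝 (1 : ℂ) := hV₀open.mem_nhds h1V₀
  have hdsl : DifferentiableOn ℂ (dslope E 1) V₀ := (Complex.differentiableOn_dslope hV₀nhds).2 h.differentiableOn_E
  have hcont : ContinuousAt (dslope E 1) 1 := (hdsl.differentiableAt hV₀nhds).continuousAt
  have hne : ∀ᶠ z in 𝓝 (1 : ℂ), dslope E 1 z ≠ 0 :=
    hcont.eventually_ne (by rw [dslope_same]; exact h.deriv_ne_zero)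
  obtain ⟨V, hVnhds, hVopen, hVsub⟩ : ∃ V ∈ 𝓝 (1 : ℂ), IsOpen V ∧ V ⊆ V₀ ∩ {z | dslope E 1 z ≠ 0} := by
    obtain ⟨V, hV, hVo, h1⟩ := mem_nhds_iff.1 (Filter.inter_mem hV₀nhds hne)
    exact ⟨V, hVo.mem_nhds h1, hVo, hV⟩
  refine ⟨V, hVnhds, ?_, fun z hz hz1 => ?_, ?_⟩
  · refine DifferentiableOn.div (DifferentiableOn.mul ?_ ((h.hk.differentiableOn_laplaceC.mono fun z hz => (hVsub hz).1).pow 2))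
      (hdsl.mono fun z hz => (hVsub hz).1) fun z hz => (hVsub hz).2
    apply Differentiable.differentiableOn; fun_prop
  · have hdz : dslope E 1 z ≠ 0 := (hVsub hz).2
    have hEz : E z = (z - 1) * dslope E 1 z := by
      have := sub_smul_dslope E 1 z
      rw [smul_eq_mul, h.E_one, sub_zero] at this
      exact this.symm
    rw [zero_add, pow_one, hEz]
    have hz1' : z - 1 ≠ 0 := sub_ne_zero.2 hz1
    field_simp
  · rw [dslope_same, h.laplaceC_k_one, one_mul, one_pow, mul_one]

/-- **The contour shift**: for `t > 0` and `a > 1`, `a > 0`, `a ≥ 2K`,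
`∫ e^{(a+iy)t}Φ(a+iy) dy − ∫ e^{(−β+iy)t}Φ(−β+iy) dy = 2π·e^{t}/E′(1)`.
[cite: Schiff1999, Theorem 4.3 (4.11)] -/
theorem integral_right_sub_integral_left (h : RenewalPoleData k k' r E K μ R a₀ β β₀) {a : ℝ} (ha : 0 < a)
    (ha1 : 1 < a) (haK : 2 * K ≤ a) {t : ℝ} (ht : 0 ≤ t) :
    (∫ y : ℝ, cexp ((a + y * I) * t) * ((laplaceC k (a + y * I)) ^ 2 / E (a + y * I))) -
      ∫ y : ℝ, cexp (((-β : ℝ) + y * I) * t) * ((laplaceC k ((-β : ℝ) + y * I)) ^ 2 / E ((-β : ℝ) + y * I)) =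
      2 * π * (cexp t / deriv E 1) := by
  set F : ℂ → ℂ := fun z => cexp (z * t) * ((laplaceC k z) ^ 2 / E z) with hF
  set U : Set ℂ := {s : ℂ | -β₀ < s.re} with hU
  have hUopen : IsOpen U := isOpen_lt continuous_const Complex.continuous_re
  have hUS : re ⁻¹' Icc (-β) a ⊆ U := fun z hz => by
    have : -β ≤ z.re := hz.1
    show -β₀ < z.re; linarith [h.hββ₀]
  -- `E ≠ 0` on both lines
  have hEa : ∀ y : ℝ, E (a + y * I) ≠ 0 := fun y => h.E_ne_zero_right ha haK (by simp)
  have hEβ : ∀ y : ℝ, E ((-β : ℝ) + y * I) ≠ 0 := fun y =>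
    h.ne_zero _ (by simp; linarith [h.hββ₀]) (by
      intro h1; have := congrArg Complex.re h1; simp at this; linarith [h.hβ])
  -- integrability of `F` on both lines from that of `Φ`
  have hnormF : ∀ (u y : ℝ), ‖F (u + y * I)‖ = Real.exp (u * t) * ‖(laplaceC k (u + y * I)) ^ 2 / E (u + y * I)‖ := by
    intro u y
    rw [hF]; dsimp only
    rw [norm_mul, Complex.norm_exp]
    congr 2
    simp [Complex.mul_re]
  have hintF : ∀ u : ℝ, -β ≤ u → (∀ y : ℝ, E (u + y * I) ≠ 0) → Integrable fun y : ℝ => F (u + y * I) := by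
    intro u hu hE0
    have hΦ := h.integrable_sq_div_vertical hu hE0
    refine Integrable.mono' (hΦ.norm.const_mul (Real.exp (u * t))) ?_ (Eventually.of_forall fun y => (hnormF u y).le)
    have hc : Continuous fun y : ℝ => F (u + y * I) := by
      rw [hF]
      exact (Continuous.cexp (by fun_prop)).mul (h.continuous_sq_div_vertical (by linarith [h.hββ₀, h.hβ₀μ]) hE0)
    exact hc.aestronglyMeasurable
  -- the pole
  obtain ⟨V, hV, hφdiff, hφeq, hφ1⟩ := h.pole_structure t
  have key := Literature.Analysis.Complex.integral_vertical_sub_eq_sum_of_poles (F := F) (σ₁ := -β) (κ := a)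
    (by linarith [h.hβ]) ({1} : Finset ℂ) (fun _ => 0) (fun _ z => cexp (z * t) * (laplaceC k z) ^ 2 / dslope E 1 z)
    U hUopen hUS (fun p hp => by
      rw [Finset.mem_singleton] at hp; subst hp; simp; exact ⟨by linarith [h.hβ], ha1⟩)
    (by
      rw [hF]
      exact (Differentiable.differentiableOn (by fun_prop)).mul h.differentiableOn_sq_div)
    (fun p hp => by
      rw [Finset.mem_singleton] at hp; subst hp
      exact ⟨V, hV, hφdiff, fun z hz hz1 => hφeq z hz hz1⟩)
    (by simpa using hintF a (by linarith [h.hβ]) hEa) (hintF (-β) le_rfl hEβ)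
    (Literature.Analysis.Complex.decay_of_bound (g := fun T : ℝ => Real.exp (a * t) * (2 * (‖k 0‖ + K / (μ - β)) ^ 2 / T ^ 2))
      (T₀ := 2 * (‖k 0‖ + K / (μ - β)) + 1) (fun T hT u hu => by
        rw [hnormF, sq_abs]
        have hb := h.norm_sq_div_le (s := u + T * I) (by simpa using hu.1) (by simpa using hT)
        simp only [add_im, ofReal_im, mul_im, ofReal_re, I_im, mul_one, I_re, mul_zero, add_zero, zero_add] at hb
        refine mul_le_mul (Real.exp_le_exp.2 (mul_le_mul_of_nonneg_right hu.2 ht)) hb (norm_nonneg _) (Real.exp_pos _).le)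
      (by
        have h0 : Tendsto (fun T : ℝ => T ^ 2) atTop atTop := tendsto_pow_atTop two_ne_zero
        have h1 : Tendsto (fun T : ℝ => (2 * (‖k 0‖ + K / (μ - β)) ^ 2) / T ^ 2) atTop (𝓝 0) :=
          tendsto_const_nhds.div_atTop h0
        simpa using h1.const_mul (Real.exp (a * t))))
  rw [Finset.sum_singleton, iteratedDeriv_zero, Nat.factorial_zero, Nat.cast_one, div_one, hφ1] at key
  simpa [hF] using key

/-! ### Step 6: the theorem -/

/-- **THE RESOLVENT OF A RENEWAL KERNEL WITH ONE SIMPLE SYMBOL ZERO** (weighted half-line Paley–Wiener, simple-pole case).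
Under `RenewalPoleData k k' r E K μ R a₀ β β₀` there is `N` with `‖r(t) − e^{t}/E′(1)‖ ≤ N e^{−βt}` for all `t ≥ 0`: the
resolvent is the growing mode `e^{t}/E′(1)` plus a remainder decaying at every rate `β < β₀` up to which the symbol has no other
zero. [cite: GripenbergLondenStaffans1990, Ch. 7 Thm 2.1 (one simple zero)] -/
theorem norm_resolvent_sub_exp_le (h : RenewalPoleData k k' r E K μ R a₀ β β₀) :
    ∃ N : ℝ, ∀ t : ℝ, 0 ≤ t → ‖r t - cexp t / deriv E 1‖ ≤ N * Real.exp (-β * t) := by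
  -- the right abscissa
  set a : ℝ := max a₀ 0 + 2 * K + 2 with ha_def
  have hK0 : 0 ≤ K := h.hk.nonneg
  have ha : 0 < a := by rw [ha_def]; linarith [le_max_right a₀ 0]
  have ha₀ : a₀ < a := by rw [ha_def]; linarith [le_max_left a₀ 0]
  have ha1 : 1 < a := by rw [ha_def]; linarith [le_max_right a₀ 0]
  have haK : 2 * K ≤ a := by rw [ha_def]; linarith [le_max_right a₀ 0]
  -- the left-line integral of `‖Φ‖`
  have hEβ : ∀ y : ℝ, E ((-β : ℝ) + y * I) ≠ 0 := fun y =>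
    h.ne_zero _ (by simp; linarith [h.hββ₀]) (by
      intro h1; have := congrArg Complex.re h1; simp at this; linarith [h.hβ])
  set NΦ : ℝ := ∫ y : ℝ, ‖(laplaceC k ((-β : ℝ) + y * I)) ^ 2 / E ((-β : ℝ) + y * I)‖ with hNΦ
  have hNΦ0 : 0 ≤ NΦ := integral_nonneg fun y => norm_nonneg _
  have hΦint := h.integrable_sq_div_vertical (u := -β) le_rfl hEβ
  refine ⟨K + ‖cexp 0 / deriv E 1‖ + (1 / (2 * π)) * NΦ, fun t ht => ?_⟩
  rcases ht.eq_or_lt with rfl | htpos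
  · -- `t = 0`: `r(0) = k(0)`
    have hr0 : r 0 = k 0 := by
      rw [h.resolvent_eq 0 le_rfl, intervalIntegral.integral_same, add_zero]
    rw [mul_zero, Real.exp_zero, mul_one, hr0, Complex.ofReal_zero]
    refine (norm_sub_le _ _).trans ?_
    have hk0 : ‖k 0‖ ≤ K := by simpa using h.hk.bound 0 le_rfl
    have : 0 ≤ 1 / (2 * π) * NΦ := by positivity
    linarith
  · -- `t > 0`: Bromwich + shift
    have hrepr := h.sub_eq_integral_right ha ha₀ haK htpos
    have hshift := h.integral_right_sub_integral_left ha ha1 haK ht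
    set Iβ : ℂ := ∫ y : ℝ, cexp (((-β : ℝ) + y * I) * t) *
      ((laplaceC k ((-β : ℝ) + y * I)) ^ 2 / E ((-β : ℝ) + y * I)) with hIβ
    have hIa : (∫ y : ℝ, cexp ((a + y * I) * t) * ((laplaceC k (a + y * I)) ^ 2 / E (a + y * I))) =
        Iβ + 2 * π * (cexp t / deriv E 1) := by rw [← hshift]; ring
    have hdecomp : r t - cexp t / deriv E 1 = k t + (1 / (2 * π) : ℝ) • Iβ := by
      rw [hIa, smul_add] at hrepr
      have h2 : (1 / (2 * π) : ℝ) • (2 * (π : ℂ) * (cexp t / deriv E 1)) = cexp t / deriv E 1 := by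
        rw [Complex.real_smul]; push_cast; field_simp
      rw [h2] at hrepr
      linear_combination hrepr
    -- bound on the left integral
    have hIβle : ‖Iβ‖ ≤ Real.exp (-β * t) * NΦ := by
      rw [hIβ, hNΦ, ← integral_const_mul]
      refine norm_integral_le_of_norm_le (hΦint.norm.const_mul _) (Eventually.of_forall fun y => ?_)
      rw [norm_mul, Complex.norm_exp]
      refine le_of_eq ?_
      congr 2
      simp [Complex.mul_re]
    rw [hdecomp]
    refine (norm_add_le _ _).trans ?_
    have hkt : ‖k t‖ ≤ K * Real.exp (-β * t) := by
      refine (h.hk.bound t ht).trans (mul_le_mul_of_nonneg_left (Real.exp_le_exp.2 ?_) hK0)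
      nlinarith [h.hββ₀, h.hβ₀μ]
    have hsm : ‖(1 / (2 * π) : ℝ) • Iβ‖ ≤ 1 / (2 * π) * (Real.exp (-β * t) * NΦ) := by
      rw [norm_smul, Real.norm_eq_abs, abs_of_pos (by positivity)]
      exact mul_le_mul_of_nonneg_left hIβle (by positivity)
    have hc0 : 0 ≤ ‖cexp 0 / deriv E 1‖ * Real.exp (-β * t) := by positivity
    nlinarith [hkt, hsm, hc0, Real.exp_pos (-β * t)]

/-- The remainder `r − e^{·}/E′(1)` is continuous. [cite: GripenbergLondenStaffans1990, Ch. 7 Thm 2.1] -/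
theorem continuous_resolvent_sub_exp (h : RenewalPoleData k k' r E K μ R a₀ β β₀) :
    Continuous fun t : ℝ => r t - cexp t / deriv E 1 :=
  h.hr.continuous.sub (by fun_prop)

/-- `∫₀ᵀ e^{−cs} ds ≤ 1/c` for `c > 0`. [folklore] -/
private theorem integral_exp_neg_mul_le {c : ℝ} (T : ℝ) (hc : 0 < c) :
    ∫ s in (0 : ℝ)..T, Real.exp (-c * s) ≤ 1 / c := by
  have hderiv : ∀ s ∈ uIcc 0 T, HasDerivAt (fun s : ℝ => -Real.exp (-c * s) / c) (Real.exp (-c * s)) s := by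
    intro s _
    have h1 : HasDerivAt (fun s : ℝ => -c * s) (-c) s := by simpa using (hasDerivAt_id s).const_mul (-c)
    have h2 := h1.exp.neg.div_const c
    refine h2.congr_deriv ?_
    field_simp
  rw [intervalIntegral.integral_eq_sub_of_hasDerivAt hderiv ((Continuous.continuousOn (by fun_prop)).intervalIntegrable)]
  have h3 : 0 < Real.exp (-c * T) := Real.exp_pos _
  rw [mul_zero, Real.exp_zero]
  have : -Real.exp (-c * T) / c - -1 / c = (1 - Real.exp (-c * T)) / c := by ring
  rw [this]
  exact div_le_div_of_nonneg_right (by linarith) hc.le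

/-- **(R-b)-ready form.** For every `β′ < β` there is `N′` with `∫₀ᵀ ‖r(s) − e^{s}/E′(1)‖ e^{β′s} ds ≤ N′` for all `T ≥ 0` — the
hypothesis shape of `Summit.NavierStokesRegularity.OSWSelfSimilar.SheetRRenewalBookkeeping.norm_renewal_sub_growing_le`
(the remainder of the resolvent lies in the weighted space `L¹(e^{β′t}dt)`). [cite: GripenbergLondenStaffans1990, Ch. 7 Thm 2.1] -/
theorem integral_norm_resolvent_sub_exp_le (h : RenewalPoleData k k' r E K μ R a₀ β β₀) {β' : ℝ} (hβ' : β' < β) :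
    ∃ N' : ℝ, ∀ T : ℝ, 0 ≤ T → ∫ s in (0 : ℝ)..T, ‖r s - cexp s / deriv E 1‖ * Real.exp (β' * s) ≤ N' := by
  obtain ⟨N, hN⟩ := h.norm_resolvent_sub_exp_le
  have hN0 : 0 ≤ N := by simpa using (norm_nonneg _).trans (hN 0 le_rfl)
  refine ⟨N * (1 / (β - β')), fun T hT => ?_⟩
  have hc : 0 < β - β' := sub_pos.2 hβ'
  have hcont : Continuous fun s : ℝ => ‖r s - cexp s / deriv E 1‖ * Real.exp (β' * s) :=
    h.continuous_resolvent_sub_exp.norm.mul (by fun_prop)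
  calc ∫ s in (0 : ℝ)..T, ‖r s - cexp s / deriv E 1‖ * Real.exp (β' * s)
      ≤ ∫ s in (0 : ℝ)..T, N * Real.exp (-(β - β') * s) := by
        refine intervalIntegral.integral_mono_on hT (hcont.intervalIntegrable 0 T)
          ((Continuous.continuousOn (by fun_prop)).intervalIntegrable) fun s hs => ?_
        calc ‖r s - cexp s / deriv E 1‖ * Real.exp (β' * s) ≤ N * Real.exp (-β * s) * Real.exp (β' * s) :=
              mul_le_mul_of_nonneg_right (hN s hs.1) (Real.exp_pos _).le
          _ = N * Real.exp (-(β - β') * s) := by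
              rw [mul_assoc, ← Real.exp_add]; ring_nf
    _ = N * ∫ s in (0 : ℝ)..T, Real.exp (-(β - β') * s) := by rw [intervalIntegral.integral_const_mul]
    _ ≤ N * (1 / (β - β')) := mul_le_mul_of_nonneg_left (integral_exp_neg_mul_le T hc) hN0

end RenewalPoleData

end Literature.Analysis.Convolution
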